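import Literature.Barriers.CriticalPhenomena.HvdHRandomWalkTriangles
import Literature.Barriers.CriticalPhenomena.LaceExpansionFourier
import Mathlib.MeasureTheory.Group.Integral
import HarnessLib

/-!
# Shifted random-walk bounds over the Brillouin zone (Heydenreich–van der Hofstad 2017,
# Exercise 5.4 / (8.3.22), (8.3.30), (8.3.33)): translation invariance for `P d`, real form

Sibling of `HvdHRandomWalkTriangles.lean` (barrier catalogue
`Literature/Barriers/CriticalPhenomena/`), a further leaf below the named fact `HvdH2017_prop83`.
The bootstrap function `f₃` brings SHIFTED Green's functions `Ĉ_λ(l ± k)` into the random-walk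
integrals of Lemmas 8.6–8.7 ((8.3.22), (8.3.30), (8.3.33); Exercise 5.4, (5.4.6)–(5.4.7)), and
every manipulation of those ("by symmetry", Hölder in `l`, (8.3.37)) uses that the integral over
the Brillouin zone of a `2π`-periodic function is invariant under `l ↦ l + k`. In `[0, ∞]` and for
the set-integral spelling `∫⁻ l in cube d` this is the tree's
`LaceExpansion.lintegral_cube_comp_add` (`LaceExpansionFourier.lean`, transport to the Haar torus
`(ℝ/2πℤ)^d`). This file restates it for the measure `Slade2006Prop53.P d` used by the percolation
files, adds the REAL (Bochner) form needed for signed integrands, and draws the first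
consequences for `Ĉ_λ`:

* `lintegral_P_comp_add`, **`integral_P_comp_add`** — `∫ F(k + a) dP = ∫ F dP` for `F` measurable
  and `2π`-periodic in every coordinate (`[0,∞]`-valued, resp. real-valued; the real form by the
  same transport: `measurePreserving_pi` of `AddCircle.measurePreserving_mk`, the measurable
  section `AddCircle.equivIco`, and `integral_add_right_eq_self` on the compact abelian group);
* periodicity of the integrands of Ch. 8: `Dhat_add_twoPi_mul`, `Chat_add_twoPi_mul`,
  `tauHat_add_twoPi_mul` (`cosFT_add_twoPi_mul` is in `LaceExpansionFourier.lean`);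
* `integral_Chat_shift_pow_le` — `∫ Ĉ_λ(k + a)ⁿ dk ≤ (2π)^d 2^{6n+2}` for every shift `a`
  (`d ≥ 2n+1`, `λ ∈ [0,1]`), with `integrable_Chat_shift_pow` and the `[0,∞]` form;
* `HvdH2017Prop55.lintegral_shell_Chat_pow_le` — the shell part alone is exponentially small,
  `∫_{1 - D̂ ≤ 1/16} Ĉ_λⁿ dk ≤ (2π)^d 2^{6n+2} 2^{-d}`, and its shifted form
  `lintegral_shell_Chat_shift_pow_le` (the two pieces of the region split behind (5.4.6)–(5.4.7)).

## References

* M. Heydenreich, R. van der Hofstad, *Progress in High-Dimensional Percolation and Random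
  Graphs* (Springer 2017): Exercise 5.4 ((5.4.6)–(5.4.8)), Lemma 8.6 ((8.3.21)–(8.3.22),
  (8.3.28)–(8.3.30)), Lemma 8.7 ((8.3.33), (8.3.37)), Prop. 5.5.
-/

noncomputable section

open MeasureTheory Filter Real Literature.Probability.LatticeModels
open Literature.Probability.Percolation
open scoped ENNReal BigOperators

namespace Literature.Barriers.CriticalPhenomena

variable {d : ℕ}

/-! Private local copies of random-walk helper lemmas of `HvdHRandomWalkTriangles.lean` whose ROOT-level
names (`srwStepFT_eq_Dhat`, `measurable_Chat`, `Chat_nonneg`, `Chat_le_sixteen`, `integral_Chat_pow_le`)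
clash with `GaussianDominationRouteRandomWalk.lean` (REFEREE v27 C37 = REFEREE-2 R14 / GAPS G19-add) and
are being retired from the root namespace there (the differing ones move to `HvdHRW.*`, the identical ones
become private); statements and proofs identical, so that this file no longer depends on the clashing
names. The four lemmas of THIS file that restate (up to normalisation) lemmas of
`GaussianDominationRouteLemma86.lean` — `Dhat_add_twoPi_mul` (≡ `Dhat_add_two_pi_mul_int`),
`Chat_add_twoPi_mul` (≡ `Chat_add_two_pi_mul_int`), `HvdH2017Prop55.measurableSet_region`
(≡ `measurableSet_regionT`), `HvdH2017Prop55.fact_two_pi_pos` (≡ `Literature.MeasureTheory.Group.fact_two_pi_pos`)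
— are now `private`: their former users downstream (`SrwIntegralLargeD.lean`, `HvdHRandomWalkShifted.lean`)
carry private copies since steps 1–2, and `Lemma86` itself cannot be imported here before the root-name
clash is gone (it imports `GaussianDominationRouteRandomWalk`). Step 3 of 4 of the lean2-g9 sequence
LargeD → Shifted → TorusShift → Triangles; every other public declaration of this file is unchanged in
name, statement and proof. -/

/-- The two spellings of `D̂` agree (local copy of `HvdHRandomWalkTriangles`' lemma). [folklore] -/
private theorem srwStepFT_eq_DhatRW (k : Fin d → ℝ) : srwStepFT d k = Dhat d k := rfl

/-- `Ĉ_λ` is measurable (local copy). [folklore] -/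
private theorem measurable_ChatRW (d : ℕ) (lam : ℝ) : Measurable (Chat d lam) := by
  have h : Measurable fun k : Fin d → ℝ => 1 - lam * Dhat d k :=
    measurable_const.sub (measurable_const.mul (continuous_Dhat d).measurable)
  have : (Chat d lam) = fun k => 1 / (1 - lam * Dhat d k) := funext fun k => rfl
  rw [this]
  exact h.const_div 1

/-- `Ĉ_λ ≥ 0` for `λ ∈ [0,1]` (local copy). [cite: HeydenreichVanDerHofstad2017, (8.2.2)] -/
private theorem Chat_nonnegRW {lam : ℝ} (hl0 : 0 ≤ lam) (hl1 : lam ≤ 1) (k : Fin d → ℝ) :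
    0 ≤ Chat d lam k := by
  have h1 : lam * Dhat d k ≤ 1 := by nlinarith [Dhat_le_one k, neg_one_le_Dhat k]
  rw [Chat]
  exact div_nonneg zero_le_one (by linarith)

open Slade2006Prop53 in
/-- Prop. 5.5, `l = 0`: `∫ Ĉ_λⁿ ≤ (2π)^d 2^{6n+2}` (local copy).
[cite: HeydenreichVanDerHofstad2017, Prop. 5.5 ((5.4.1)–(5.4.2))] -/
private theorem integral_Chat_pow_leRW (n : ℕ) (hd : 2 * n + 1 ≤ d) {lam : ℝ} (hl0 : 0 ≤ lam)
    (hl1 : lam ≤ 1) : ∫ k, Chat d lam k ^ n ∂P d ≤ (2 * π) ^ d * 2 ^ (6 * n + 2) := by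
  rw [integral_eq_lintegral_of_nonneg_ae (ae_of_all _ fun k => pow_nonneg (Chat_nonnegRW hl0 hl1 k) n)
    ((measurable_ChatRW d lam).pow_const n).aestronglyMeasurable]
  exact ENNReal.toReal_le_of_le_ofReal (by positivity)
    (HvdH2017Prop55.lintegral_Chat_pow_le n hd hl0 hl1)

/-! ### Periodicity of the integrands -/

/-- `D̂(k + 2πn) = D̂(k)` for `n ∈ ℤ^d`. [folklore] -/
private theorem Dhat_add_twoPi_mul (k : Fin d → ℝ) (n : Fin d → ℤ) :
    Dhat d (fun j => k j + 2 * π * n j) = Dhat d k := by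
  simp only [Dhat]
  congr 1
  refine Finset.sum_congr rfl fun j _ => ?_
  rw [mul_comm (2 * π), Real.cos_add_int_mul_two_pi]

/-- `Ĉ_λ(k + 2πn) = Ĉ_λ(k)` for `n ∈ ℤ^d`. [folklore] -/
private theorem Chat_add_twoPi_mul (lam : ℝ) (k : Fin d → ℝ) (n : Fin d → ℤ) :
    Chat d lam (fun j => k j + 2 * π * n j) = Chat d lam k := by
  rw [Chat, Chat, Dhat_add_twoPi_mul]

/-- `τ̂_p(k + 2πn) = τ̂_p(k)`. [folklore] -/
theorem tauHat_add_twoPi_mul (p : unitInterval) (k : Fin d → ℝ) (n : Fin d → ℤ) :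
    tauHat d p (fun j => k j + 2 * π * n j) = tauHat d p k := by
  rw [tauHat_eq_cosFT, LaceExpansion.cosFT_add_twoPi_mul]

/-! ### Translation invariance for `P d` -/

namespace HvdH2017Prop55

open Slade2006Prop53

/-- `2π > 0`, as a `Fact` for `AddCircle (2π)` (supplied by `haveI` inside proofs; deliberately
not an instance). [folklore] -/
private theorem fact_two_pi_pos : Fact (0 < 2 * π) := ⟨by positivity⟩

/-- The covering map `[-π,π] → ℝ/2πℤ` is measure-preserving from Lebesgue measure on `[-π,π]` to
Haar measure (of mass `2π`) on the circle. [folklore] -/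
theorem measurePreserving_coe_μI [Fact (0 < 2 * π)] :
    MeasurePreserving ((↑) : ℝ → AddCircle (2 * π)) μI volume := by
  have e : volume.restrict (Set.Ioc (-π) (-π + 2 * π)) = μI := by
    rw [show -π + 2 * π = π by ring]
    exact Measure.restrict_congr_set Ioc_ae_eq_Icc
  rw [← e]
  exact AddCircle.measurePreserving_mk (2 * π) (-π)

/-- The coordinatewise covering map `[-π,π]^d → (ℝ/2πℤ)^d` is measure-preserving from `P d` to the
product Haar measure. [folklore] -/
theorem measurePreserving_coe_pi [Fact (0 < 2 * π)] (d : ℕ) :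
    MeasurePreserving (fun (k : Fin d → ℝ) (i : Fin d) => ((k i : ℝ) : AddCircle (2 * π))) (P d)
      (Measure.pi fun _ : Fin d => (volume : Measure (AddCircle (2 * π)))) :=
  measurePreserving_pi (fun _ => μI) (fun _ => volume) fun _ => measurePreserving_coe_μI

/-- The measurable section `ℝ/2πℤ → [-π, π) ⊆ ℝ` differs from any preimage by a period:
`s(↑x) = x + 2πn` for some `n ∈ ℤ`. [folklore] -/
theorem section_coe [Fact (0 < 2 * π)] (x : ℝ) :
    ∃ n : ℤ, ((AddCircle.equivIco (2 * π) (-π) (x : AddCircle (2 * π)) : ℝ)) = x + 2 * π * n := by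
  have h : ((((AddCircle.equivIco (2 * π) (-π) (x : AddCircle (2 * π)) : ℝ)) - x : ℝ) :
      AddCircle (2 * π)) = 0 := by
    rw [AddCircle.coe_sub, sub_eq_zero]
    exact AddCircle.coe_equivIco
  obtain ⟨n, hn⟩ := (AddCircle.coe_eq_zero_iff (2 * π)).1 h
  refine ⟨n, ?_⟩
  rw [zsmul_eq_mul] at hn
  linarith

end HvdH2017Prop55

open Slade2006Prop53 in
/-- Translation invariance of Brillouin-zone integrals in `[0, ∞]`, for the measure `P d`: for `F`
measurable and `2π`-periodic in every coordinate, `∫ F(k + a) dP(k) = ∫ F dP` (the tree's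
`LaceExpansion.lintegral_cube_comp_add`, respelled). [folklore] -/
theorem lintegral_P_comp_add {F : (Fin d → ℝ) → ℝ≥0∞} (hFm : Measurable F)
    (hF : ∀ (k : Fin d → ℝ) (n : Fin d → ℤ), F (fun j => k j + 2 * π * n j) = F k)
    (a : Fin d → ℝ) : ∫⁻ k, F (k + a) ∂P d = ∫⁻ k, F k ∂P d := by
  have h := LaceExpansion.lintegral_cube_comp_add F hFm hF a
  rwa [LaceExpansion.volume_restrict_cube_eq] at h

open HvdH2017Prop55 Slade2006Prop53 in
/-- **Translation invariance of Brillouin-zone integrals, real form**: for `F : ℝ^d → ℝ`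
measurable and `2π`-periodic in every coordinate and any `a ∈ ℝ^d`,
`∫_{[-π,π]^d} F(k + a) dk = ∫_{[-π,π]^d} F(k) dk` (no sign or integrability assumption: both
sides are Bochner integrals of the same function on the torus).
[cite: HeydenreichVanDerHofstad2017, Exercise 5.4 and (8.3.37)] -/
theorem integral_P_comp_add {F : (Fin d → ℝ) → ℝ} (hFm : Measurable F)
    (hF : ∀ (k : Fin d → ℝ) (n : Fin d → ℤ), F (fun j => k j + 2 * π * n j) = F k)
    (a : Fin d → ℝ) : ∫ k, F (k + a) ∂P d = ∫ k, F k ∂P d := by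
  haveI : Fact (0 < 2 * π) := fact_two_pi_pos
  set Φ : (Fin d → ℝ) → (Fin d → AddCircle (2 * π)) :=
    fun k i => ((k i : ℝ) : AddCircle (2 * π)) with hΦ
  have hΦmp := measurePreserving_coe_pi d
  set s : AddCircle (2 * π) → ℝ :=
    fun θ => ((AddCircle.equivIco (2 * π) (-π) θ : Set.Ico (-π) (-π + 2 * π)) : ℝ) with hs
  have hsm : Measurable s :=
    measurable_subtype_coe.comp (AddCircle.measurableEquivIco (2 * π) (-π)).measurable
  set Ft : (Fin d → AddCircle (2 * π)) → ℝ := fun θ => F (fun i => s (θ i)) with hFt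
  have hFtm : Measurable Ft :=
    hFm.comp (measurable_pi_lambda _ fun i => hsm.comp (measurable_pi_apply i))
  have hlift : ∀ k : Fin d → ℝ, Ft (Φ k) = F k := by
    intro k
    choose n hn using fun i => section_coe (k i)
    have e : (fun i => s (((k i : ℝ) : AddCircle (2 * π)))) = fun j => k j + 2 * π * n j :=
      funext fun i => hn i
    show F (fun i => s (((k i : ℝ) : AddCircle (2 * π)))) = F k
    rw [e, hF]
  have hΦadd : ∀ k : Fin d → ℝ, Φ (k + a) = Φ k + Φ a := by
    intro k; funext i; simp only [hΦ, Pi.add_apply, AddCircle.coe_add]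
  have hmap := hΦmp.map_eq
  calc ∫ k, F (k + a) ∂P d = ∫ k, (fun θ => Ft (θ + Φ a)) (Φ k) ∂P d := by
        simp_rw [← hlift, hΦadd]
    _ = ∫ θ, Ft (θ + Φ a) ∂(Measure.pi fun _ => volume) := by
        rw [← hmap, integral_map hΦmp.measurable.aemeasurable]
        exact (hFtm.comp (measurable_add_const _)).aestronglyMeasurable
    _ = ∫ θ, Ft θ ∂(Measure.pi fun _ => volume) := integral_add_right_eq_self _ _
    _ = ∫ k, Ft (Φ k) ∂P d := by
        rw [← hmap, integral_map hΦmp.measurable.aemeasurable]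
        exact hFtm.aestronglyMeasurable
    _ = ∫ k, F k ∂P d := by simp_rw [hlift]

/-! ### Shifted random-walk bounds -/

open Slade2006Prop53 in
/-- `∫ Ĉ_λ(k + a)ⁿ dk ≤ (2π)^d 2^{6n+2}` in `[0, ∞]`, for every shift `a` (`d ≥ 2n + 1`,
`λ ∈ [0,1]`). [cite: HeydenreichVanDerHofstad2017, Exercise 5.4 and Prop. 5.5] -/
theorem lintegral_Chat_shift_pow_le (n : ℕ) (hd : 2 * n + 1 ≤ d) {lam : ℝ} (hl0 : 0 ≤ lam)
    (hl1 : lam ≤ 1) (a : Fin d → ℝ) :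
    ∫⁻ k, ENNReal.ofReal (Chat d lam (k + a) ^ n) ∂P d ≤
      ENNReal.ofReal ((2 * π) ^ d * 2 ^ (6 * n + 2)) := by
  rw [lintegral_P_comp_add (F := fun k => ENNReal.ofReal (Chat d lam k ^ n))
    ((measurable_ChatRW d lam).pow_const n).ennreal_ofReal
    (fun k m => by simp only [Chat_add_twoPi_mul]) a]
  exact HvdH2017Prop55.lintegral_Chat_pow_le n hd hl0 hl1

open Slade2006Prop53 in
/-- `Ĉ_λ(· + a)ⁿ` is integrable on the cube (`d ≥ 2n + 1`, `λ ∈ [0,1]`).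
[cite: HeydenreichVanDerHofstad2017, Exercise 5.4 and Prop. 5.5] -/
theorem integrable_Chat_shift_pow (n : ℕ) (hd : 2 * n + 1 ≤ d) {lam : ℝ} (hl0 : 0 ≤ lam)
    (hl1 : lam ≤ 1) (a : Fin d → ℝ) : Integrable (fun k => Chat d lam (k + a) ^ n) (P d) := by
  refine ⟨?_, ?_⟩
  · exact (((measurable_ChatRW d lam).comp (measurable_add_const a)).pow_const n).aestronglyMeasurable
  rw [hasFiniteIntegral_iff_ofReal (ae_of_all _ fun k => pow_nonneg (Chat_nonnegRW hl0 hl1 _) n)]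
  exact lt_of_le_of_lt (lintegral_Chat_shift_pow_le n hd hl0 hl1 a) ENNReal.ofReal_lt_top

open Slade2006Prop53 in
/-- **Shifted Prop. 5.5, `l = 0`**: `∫_{[-π,π]^d} Ĉ_λ(k + a)ⁿ dk ≤ (2π)^d · 2^{6n+2}` for every
shift `a ∈ ℝ^d` (`d ≥ 2n + 1`, `λ ∈ [0,1]`) — e.g. `∫ Ĉ_λ(l ± k)³ dl ≤ (2π)^d 2^{20}` uniformly in
`k`, as used for (8.3.30) and (8.3.37).
[cite: HeydenreichVanDerHofstad2017, Exercise 5.4 and (8.3.37)] -/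
theorem integral_Chat_shift_pow_le (n : ℕ) (hd : 2 * n + 1 ≤ d) {lam : ℝ} (hl0 : 0 ≤ lam)
    (hl1 : lam ≤ 1) (a : Fin d → ℝ) :
    ∫ k, Chat d lam (k + a) ^ n ∂P d ≤ (2 * π) ^ d * 2 ^ (6 * n + 2) := by
  rw [integral_P_comp_add (F := fun k => Chat d lam k ^ n)
    ((measurable_ChatRW d lam).pow_const n) (fun k m => by simp only [Chat_add_twoPi_mul]) a]
  exact integral_Chat_pow_leRW n hd hl0 hl1

/-! ### The shell part is exponentially small in `d` -/

namespace HvdH2017Prop55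

open Slade2006Prop53

/-- The region `{1 - D̂ ≤ 1/16}` has volume `≤ (2π)^d 2^{-d}`. [folklore] -/
theorem measure_region_le (hd : 1 ≤ d) :
    P d {k : Fin d → ℝ | 1 - Dhat d k ≤ 1 / 16} ≤ ENNReal.ofReal ((2 * π) ^ d * (1 / 2) ^ d) := by
  have h := measure_shell_le hd 2
  have e : {k : Fin d → ℝ | 1 - srwStepFT d k ≤ (1 / 4 : ℝ) ^ 2} =
      {k : Fin d → ℝ | 1 - Dhat d k ≤ 1 / 16} := by
    ext k; simp only [Set.mem_setOf_eq, srwStepFT_eq_DhatRW]; norm_num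
  rw [e] at h
  refine h.trans (le_of_eq ?_)
  norm_num

/-- The region `{1 - D̂ ≤ 1/16}` is measurable. [folklore] -/
private theorem measurableSet_region (d : ℕ) : MeasurableSet {k : Fin d → ℝ | 1 - Dhat d k ≤ 1 / 16} :=
  measurableSet_le (measurable_const.sub (continuous_Dhat d).measurable) measurable_const

/-- **The shell part of Prop. 5.5 is exponentially small**: for `d ≥ 2n + 1` and `λ ∈ [0,1]`,
`∫_{1 - D̂ ≤ 1/16} Ĉ_λ(k)ⁿ dk ≤ (2π)^d 2^{6n+2} 2^{-d}` (in `[0, ∞]`).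
[cite: HeydenreichVanDerHofstad2017, Prop. 5.5 (proof)] -/
theorem lintegral_shell_Chat_pow_le (n : ℕ) (hd : 2 * n + 1 ≤ d) {lam : ℝ} (hl0 : 0 ≤ lam)
    (hl1 : lam ≤ 1) :
    ∫⁻ k, {k : Fin d → ℝ | 1 - Dhat d k ≤ 1 / 16}.indicator
        (fun k => ENNReal.ofReal (Chat d lam k ^ n)) k ∂P d ≤
      ENNReal.ofReal ((2 * π) ^ d * 2 ^ (6 * n + 2) * (1 / 2) ^ d) := by
  have hd1 : 1 ≤ d := le_trans (by omega) hd
  set T := {k : Fin d → ℝ | 1 - Dhat d k ≤ 1 / 16} with hT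
  have hTm : MeasurableSet T := measurableSet_region d
  -- weight `w = 𝟙_T`
  have hw := lintegral_weight_mul_Chat_pow_le n hd hl0 hl1 (w := T.indicator fun _ => (1 : ℝ))
    (measurable_const.indicator hTm)
    (fun k => Set.indicator_nonneg (fun _ _ => zero_le_one) k)
    (fun k => Set.indicator_le_self' (fun _ _ => zero_le_one) k)
  have e1 : (fun k => ENNReal.ofReal ((T.indicator fun _ => (1 : ℝ)) k * Chat d lam k ^ n)) =
      fun k => T.indicator (fun k => ENNReal.ofReal (Chat d lam k ^ n)) k := by
    funext k
    by_cases hk : k ∈ T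
    · simp [Set.indicator_of_mem hk]
    · simp [Set.indicator_of_notMem hk]
  have e2 : (fun k => ENNReal.ofReal ((T.indicator fun _ => (1 : ℝ)) k)) =
      fun k => T.indicator (fun _ => (1 : ℝ≥0∞)) k := by
    funext k
    by_cases hk : k ∈ T
    · simp [Set.indicator_of_mem hk]
    · simp [Set.indicator_of_notMem hk]
  rw [e1, e2, lintegral_indicator_const hTm, one_mul] at hw
  refine hw.trans ?_
  calc (16 : ℝ≥0∞) ^ n * P d T + ENNReal.ofReal ((2 * π) ^ d * 2 ^ (6 * n + 1) * (1 / 2) ^ d)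
      ≤ 16 ^ n * ENNReal.ofReal ((2 * π) ^ d * (1 / 2) ^ d) +
          ENNReal.ofReal ((2 * π) ^ d * 2 ^ (6 * n + 1) * (1 / 2) ^ d) := by
        gcongr
        exact measure_region_le hd1
    _ = ENNReal.ofReal (16 ^ n * ((2 * π) ^ d * (1 / 2) ^ d) +
          (2 * π) ^ d * 2 ^ (6 * n + 1) * (1 / 2) ^ d) := by
        rw [ENNReal.ofReal_add (by positivity) (by positivity),
          ENNReal.ofReal_mul (p := (16 : ℝ) ^ n) (by positivity),
          ENNReal.ofReal_pow (p := (16 : ℝ)) (by norm_num), ENNReal.ofReal_ofNat]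
    _ ≤ ENNReal.ofReal ((2 * π) ^ d * 2 ^ (6 * n + 2) * (1 / 2) ^ d) := by
        refine ENNReal.ofReal_le_ofReal ?_
        have h2 : (16 : ℝ) ^ n = 2 ^ (4 * n) := by
          rw [show (16 : ℝ) = 2 ^ 4 by norm_num, ← pow_mul]
        have h3 : (2 : ℝ) ^ (4 * n) ≤ 2 ^ (6 * n + 1) :=
          pow_le_pow_right₀ (by norm_num) (by omega)
        have h4 : (2 : ℝ) ^ (6 * n + 2) = 2 ^ (6 * n + 1) + 2 ^ (6 * n + 1) := by
          rw [pow_succ]; ring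
        have hπ : 0 ≤ (2 * π) ^ d * (1 / 2) ^ d := by positivity
        calc (16 : ℝ) ^ n * ((2 * π) ^ d * (1 / 2) ^ d) +
              (2 * π) ^ d * 2 ^ (6 * n + 1) * (1 / 2) ^ d
            ≤ 2 ^ (6 * n + 1) * ((2 * π) ^ d * (1 / 2) ^ d) +
              (2 * π) ^ d * 2 ^ (6 * n + 1) * (1 / 2) ^ d := by rw [h2]; gcongr
          _ = (2 * π) ^ d * 2 ^ (6 * n + 2) * (1 / 2) ^ d := by rw [h4]; ring

/-- The shifted shell part: `∫ 𝟙{1 - D̂(k+a) ≤ 1/16} Ĉ_λ(k+a)ⁿ dk ≤ (2π)^d 2^{6n+2} 2^{-d}`, for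
every shift `a` (`d ≥ 2n + 1`, `λ ∈ [0,1]`). [cite: HeydenreichVanDerHofstad2017, Exercise 5.4] -/
theorem lintegral_shell_Chat_shift_pow_le (n : ℕ) (hd : 2 * n + 1 ≤ d) {lam : ℝ} (hl0 : 0 ≤ lam)
    (hl1 : lam ≤ 1) (a : Fin d → ℝ) :
    ∫⁻ k, {k : Fin d → ℝ | 1 - Dhat d k ≤ 1 / 16}.indicator
        (fun k => ENNReal.ofReal (Chat d lam k ^ n)) (k + a) ∂P d ≤
      ENNReal.ofReal ((2 * π) ^ d * 2 ^ (6 * n + 2) * (1 / 2) ^ d) := by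
  rw [lintegral_P_comp_add
    (F := fun k => {k : Fin d → ℝ | 1 - Dhat d k ≤ 1 / 16}.indicator
      (fun k => ENNReal.ofReal (Chat d lam k ^ n)) k)
    ((((measurable_ChatRW d lam).pow_const n).ennreal_ofReal).indicator (measurableSet_region d))
    (fun k m => ?_) a]
  · exact lintegral_shell_Chat_pow_le n hd hl0 hl1
  · simp only [Set.indicator, Set.mem_setOf_eq, Dhat_add_twoPi_mul, Chat_add_twoPi_mul]

end HvdH2017Prop55

end Literature.Barriers.CriticalPhenomena

end
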